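import Literature.Analysis.FluidPDE.KochTataruPairing
import Literature.Analysis.FluidPDE.KochTataruDuhamelDecay
import Literature.Analysis.FluidPDE.KochTataruHeatSlice
import Literature.Analysis.FluidPDE.BoundedAnnihilator
import Literature.Analysis.FluidPDE.OseenKernelSemigroup
import HarnessLib

/-!
# Koch–Tataru's class solutions solve the integral equation: (T4) `integral_of_isKochTataruSolution`

Analysis/FluidPDE proof companion of `Literature/Analysis/FluidPDE/KochTataru.lean` (the
decomposition of the named fact `Literature.Analysis.FluidPDE.koch_tataru`, **ns.S15**,
Koch–Tataru, Adv. Math. 157 (2001), Theorem 2, into (L1), (L2), (T1)–(T4)). This file works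
towards **(T4) `integral_of_isKochTataruSolution`**: a solution `v` in Koch–Tataru's class
(duality-form mild, measurable on `(0,∞) × E`, `BMO⁻¹` slices) from weakly divergence-free,
polynomially tempered `u₀ ∈ BMO⁻¹`, with `‖v‖_X < ∞`, satisfies the integral equation (11) a.e. on
every positive slice, `v(t) = e^{tΔ}u₀ - B(v, v)(t)`, and `v(0) = u₀` a.e. — "very weak ⇒ integral
(Oseen)" for fields vanishing at infinity (Lemarié-Rieusset 2016, Thm. 6.1, (6.11) ⇒ (6.12), with
Lemma 6.4 (B) and Prop. 6.5; Def. 6.4–6.5 for "vanishing at infinity").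

The mechanism in the tree's encoding (no pressure, no `𝓢'`): `g(t) := v(t) - e^{tΔ}u₀ + B(v,v)(t)`
is annihilated by every solenoidal test field (the duality identity of the class against the
datum symmetry `∫⟪e^{tΔ}u₀, φ⟫ = ∫⟪u₀, e^{tΔ}φ⟫` and the tested Duhamel identity of
`KochTataruPairing.lean`), is weakly divergence free, bounded and measurable; by the annihilator
lemma in `L^∞` (`BoundedAnnihilator.lean`) it is a.e. a constant `c`, and `c = e^{τΔ}g(t)(0) → 0`
as `τ → ∞`: `e^{τΔ}v(t) → 0` and `e^{τΔ}e^{tΔ}u₀ → 0` because bounded (hence tempered) `BMO⁻¹`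
fields vanish at infinity by Koch–Tataru's (22), `|e^{τΔ}w| ≤ C τ^{-1/2}‖w‖_{BMO⁻¹}`
(`tendsto_heatExtension_atTop_of_memBMOInvVec`, with `MemBMOInvVec.heatExtension` of
`KochTataruHeatSlice.lean` for the free evolution), and `e^{τΔ}B(v,v)(t) → 0` by the semigroup law
for the kernel and the decay estimate of `KochTataruDuhamelDecay.lean`. At `t = 0`,
`v(0) - u₀ ∈ BMO⁻¹` is weakly solenoidal and annihilated by solenoidal tests, hence zero by the
annihilator lemma in `BMO⁻¹` (`BMOInvAnnihilator.lean`).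

This file proves the positive-time clause of (T4) (all **proved**; the `t = 0` clause and the
assembly of `integral_of_isKochTataruSolution_holds` follow in the next file, with the annihilator
lemma in `BMO⁻¹`):

* `§ Vanishing`: a.e. bounded, measurable `BMO⁻¹` fields are polynomially tempered and vanish at
  infinity under the heat flow (`tendsto_heatExtension_atTop_of_memBMOInvVec`);
* `§ HeatAnnihilator`: **a bounded, weakly solenoidal field annihilated by solenoidal tests whose
  heat flow tends to zero at one point vanishes a.e.**
  (`IsWeaklyDivFree.ae_eq_zero_of_forall_integral_inner_eq_zero_of_tendsto_heatExtension`);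
* `§ DuhamelHeat`: `e^{τΔ}[B(u,v)(t)](x) = ∫∫_{(0,t)×E} K(t - s + τ, x - y)[u, v]`
  (`heatExtension_kochTataruBilinear_eq`, Fubini and the kernel semigroup law
  `integral_heatKernel_sub_smul_oseenKernel_sub` of `OseenKernelSemigroup.lean`) and
  `‖e^{τΔ}B(u,v)(t)‖ ≤ C τ^{-1/2}‖u‖_X‖v‖_X → 0` (`tendsto_heatExtension_kochTataruBilinear_atTop`,
  the decay estimate of `KochTataruDuhamelDecay.lean`);
* `§ Datum`: the free evolution of the datum against test fields — the symmetry
  `∫ ⟪e^{tΔ}u₀, φ⟫ = ∫ ⟪u₀, e^{tΔ}φ⟫` (`integral_inner_heatExtension_eq_of_hasCompactSupport`,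
  componentwise `BMOInv.integral_heatExtension_mul_eq`) and weak divergence-freeness of `e^{tΔ}u₀`
  for weakly divergence-free tempered `u₀` (`isWeaklyDivFree_heatExtension`, via
  `IsWeaklyDivFree.integral_fderiv_apply_eq_zero` applied to the Gaussian-decaying `e^{tΔ}θ`);
* `§ PositiveSlices`: slice facts (`exists_norm_heatExtension_le_of_memBMOInvVec`,
  `aestronglyMeasurable_of_memBMOInvVec`) and the main result
  **`IsKochTataruSolution.ae_eq_heatExtension_sub_kochTataruBilinear`**: for `u₀` weakly
  divergence free, polynomially tempered, in `BMO⁻¹`, a class solution `v` with `‖v‖_X < ∞`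
  satisfies `v(t) = e^{tΔ}u₀ - B(v, v)(t)` a.e. for every `t > 0`.

## Mathlib / tree search

Tree (`lean search 'heatExtension.*kochTataruBilinear|tendsto_heatExtension|isWeaklyDivFree_heat' --decl`:
nothing on these): `KochTataruPairing.lean` (`integral_inner_kochTataruBilinear_eq_neg_intervalIntegral`,
`isWeaklyDivFree_kochTataruBilinear`, `stronglyMeasurable_kochTataruBilinear_slice`,
`exists_norm_kochTataruBilinear_le`), `KochTataruPointwise.lean`
(`exists_lintegral_enorm_oseenKernel_duhamel_le`, `AEMeasurable.oseenKernel_comp`),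
`KochTataruDuhamelDecay.lean` (`kochTataruBilinear_eq_integral_prod`,
`exists_lintegral_enorm_oseenKernel_shifted_le'`), `OseenKernelSemigroup.lean`
(`integral_heatKernel_sub_smul_oseenKernel_sub`), `KochTataruHeatSlice.lean`
(`MemBMOInvVec.heatExtension`), `KochTataruLinear.lean` (`inner_heatExtension_eq_heatExtension_inner`,
`heatExtension_eq_sum_heatExtension_inner`, `IsPolynomiallyTempered.inner_const/integrable_growth_norm`),
`KochTataruFixedPoint.lean` (`ae_enorm_slice_le`), `BMOCarleson*` (`exists_abs_heatExtension_le`,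
`memBMOInv_iff_carleson_heat_holds`, `integral_heatExtension_mul_eq`,
`integrable_mul_heatExtension_of_growth`, `exists_unif_bound_heatExtension`,
`exists_abs_heatExtension_le_of_support`), `BoundedAnnihilator.lean`
(`IsWeaklyDivFree.exists_ae_eq_const_of_norm_le_of_forall_integral_inner_eq_zero`), `WeakGradientIBP`
(`IsWeaklyDivFree.integral_fderiv_apply_eq_zero`, `inner_gradient_eq_fderiv_apply`), `MildSolution.lean`
(`heatTest_of_pos`). Mathlib: `integral_integral_swap`, `lintegral_prod`, `tendsto_nhds_unique`,
`Real.tendsto_sqrt_atTop`, `tendsto_rpow_neg_atTop`.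

## References

* H. Koch, D. Tataru, *Well-posedness for the Navier–Stokes equations*, Adv. Math. 157 (2001)
  22–35, Theorems 1–2, §3 (11), §4 (22). Bib key `KochTataruAdvMath2001`.
* P. G. Lemarié-Rieusset, *The Navier–Stokes problem in the 21st century*, CRC Press 2016,
  Ch. 6: Def. 6.4–6.5, Lemma 6.4 (B), Thm. 6.1, Prop. 6.5. Bib key `LemarieRieusset2016`.
-/

noncomputable section

open MeasureTheory Set Function Filter Metric TopologicalSpace InnerProductSpace
open _root_.Topology _root_.Real
open scoped ENNReal NNReal RealInnerProductSpace

namespace Literature.Analysis.FluidPDE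

variable {E : Type*} [NormedAddCommGroup E] [InnerProductSpace ℝ E] [FiniteDimensional ℝ E]
  [MeasurableSpace E] [BorelSpace E]

/-! ## Bounded `BMO⁻¹` fields vanish at infinity under the heat flow -/

section Vanishing

/-- The polynomial weight `(1 + ‖y‖²)^{-(d+1)}` is integrable. [folklore] -/
theorem integrable_inv_one_add_norm_sq_pow_finrank_succ :
    Integrable fun y : E => ((1 + ‖y‖ ^ 2) ^ (Module.finrank ℝ E + 1) : ℝ)⁻¹ := by
  set N : ℕ := Module.finrank ℝ E + 1 with hN
  have h := integrable_rpow_neg_one_add_norm_sq (E := E) (μ := volume) (r := 2 * N)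
    (by rw [hN]; push_cast; linarith)
  refine h.congr (Eventually.of_forall fun y => ?_)
  simp only
  rw [show -(2 * (N : ℝ)) / 2 = -(N : ℝ) by ring, Real.rpow_neg (by positivity), Real.rpow_natCast]

/-- **An a.e. bounded measurable field is polynomially tempered** (weight `(1 + ‖y‖²)^{-(d+1)}`).
[folklore] -/
theorem IsPolynomiallyTempered.of_ae_norm_le {f : E → E} (hf : AEStronglyMeasurable f volume)
    {M : ℝ} (hM : ∀ᵐ x ∂(volume : Measure E), ‖f x‖ ≤ M) : IsPolynomiallyTempered f := by
  have hw := integrable_inv_one_add_norm_sq_pow_finrank_succ (E := E)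
  refine ⟨Module.finrank ℝ E + 1, (hw.mul_const M).mono' (hw.aestronglyMeasurable.smul hf) ?_⟩
  filter_upwards [hM] with y hy
  rw [norm_smul, Real.norm_of_nonneg (by positivity)]
  exact mul_le_mul_of_nonneg_left hy (by positivity)

omit [FiniteDimensional ℝ E] [MeasurableSpace E] [BorelSpace E] in
/-- A vector-valued function tends to zero if its components in an orthonormal frame do.
[folklore] -/
theorem tendsto_zero_of_forall_inner {ι α : Type*} [Fintype ι] (e : OrthonormalBasis ι ℝ E)
    {F : α → E} {l : Filter α} (h : ∀ i, Tendsto (fun a => ⟪F a, e i⟫) l (𝓝 0)) :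
    Tendsto F l (𝓝 0) := by
  have heq : F = fun a => ∑ i, ⟪F a, e i⟫ • e i := by
    funext a
    conv_lhs => rw [← e.sum_repr' (F a)]
    exact Finset.sum_congr rfl fun i _ => by rw [real_inner_comm]
  rw [heq, show (0 : E) = ∑ i : ι, (0 : ℝ) • e i by simp]
  exact tendsto_finsetSum _ fun i _ => (h i).smul_const (e i)

/-- **Bounded `BMO⁻¹` fields vanish at infinity under the heat flow** (Koch–Tataru 2001, (22):
`|e^{τΔ}w| ≤ C τ^{-1/2} ‖w‖_{BMO⁻¹}`; Lemarié-Rieusset 2016, Def. 6.5): if `f : E → E` is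
measurable, a.e. bounded, and every component `⟪f, v⟫` lies in `BMO⁻¹` (`MemBMOInvVec`), then
`e^{τΔ}f (x) → 0` as `τ → ∞`, for every `x`. Componentwise: `⟪e^{τΔ}f, v⟫ = e^{τΔ}⟪f, v⟫`
(`inner_heatExtension_eq_heatExtension_inner`), the Carleson quantity of `⟪f, v⟫` is finite by
Koch–Tataru's Theorem 1 (`memBMOInv_iff_carleson_heat_holds`), and (22) is
`BMOInv.exists_abs_heatExtension_le`. [cite: KochTataruAdvMath2001, Theorem 1 and (22)] -/
theorem tendsto_heatExtension_atTop_of_memBMOInvVec {f : E → E} (hf : AEStronglyMeasurable f volume)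
    {M : ℝ} (hM : ∀ᵐ x ∂(volume : Measure E), ‖f x‖ ≤ M) (hBMO : FunctionSpaces.MemBMOInvVec f)
    (x : E) :
    Tendsto (fun τ => UnboundedOperators.heatExtension f τ x) atTop (𝓝 0) := by
  have htemp : IsPolynomiallyTempered f := IsPolynomiallyTempered.of_ae_norm_le hf hM
  obtain ⟨C₁, hC₁, habs⟩ := FunctionSpaces.BMOInv.exists_abs_heatExtension_le (E := E)
  refine tendsto_zero_of_forall_inner (stdOrthonormalBasis ℝ E) fun i => ?_
  set v : E := stdOrthonormalBasis ℝ E i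
  set w : E → ℝ := fun y => ⟪f y, v⟫ with hw
  obtain ⟨N, hN⟩ := htemp.inner_const v
  have hfw := FunctionSpaces.BMOInv.integrable_growth_of_tempered hN
  obtain ⟨Φ, -, hrep⟩ := id (hBMO v)
  have hγ : FunctionSpaces.BMOInv.eCarlesonNorm w < ∞ :=
    (FunctionSpaces.memBMOInv_iff_carleson_heat_holds hrep.locallyIntegrable ⟨N, hN⟩).1 (hBMO v)
  set K : ℝ := C₁ * Real.sqrt (FunctionSpaces.BMOInv.eCarlesonNorm w).toReal with hK
  -- `|⟪e^{τΔ}f (x), v⟫| ≤ K / √τ` for `τ > 0`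
  have hbd : ∀ τ : ℝ, 0 < τ → |⟪UnboundedOperators.heatExtension f τ x, v⟫| ≤ K / Real.sqrt τ := by
    intro τ hτ
    rw [inner_heatExtension_eq_heatExtension_inner htemp hτ x v]
    exact habs hfw hγ hτ x
  have hlim : Tendsto (fun τ : ℝ => K / Real.sqrt τ) atTop (𝓝 0) := by
    have h := Real.tendsto_sqrt_atTop
    simpa using tendsto_const_nhds.div_atTop h
  refine squeeze_zero_norm' ?_ hlim
  filter_upwards [eventually_gt_atTop 0] with τ hτ
  rw [Real.norm_eq_abs]
  exact hbd τ hτ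

end Vanishing

/-! ## The annihilator lemma with the heat flow: bounded annihilated solenoidal fields vanishing at infinity are zero -/

section HeatAnnihilator

/-- The caloric extension of an a.e. constant is that constant (`∫ G_τ = 1`). [folklore] -/
theorem heatExtension_eq_const_of_ae_eq {g : E → E} {c : E} (h : g =ᵐ[volume] fun _ => c)
    {τ : ℝ} (hτ : 0 < τ) (x : E) : UnboundedOperators.heatExtension g τ x = c := by
  rw [UnboundedOperators.heatExtension_eq_integral_sub]
  have h1 : ∫ y, UnboundedOperators.heatKernel τ (x - y) • g y = ∫ y, UnboundedOperators.heatKernel τ (x - y) • c :=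
    integral_congr_ae (h.mono fun y hy => by simp only [hy])
  rw [h1, integral_smul_const, integral_sub_left_eq_self (fun y => UnboundedOperators.heatKernel τ y) volume x,
    UnboundedOperators.integral_heatKernel_eq_one_holds hτ, one_smul]

/-- **A bounded, weakly solenoidal field annihilated by solenoidal tests, whose heat flow tends to
zero at one point, vanishes a.e.** Let `g : E → E` be measurable and a.e. bounded, weakly
divergence free, with `∫ ⟪g, φ⟫ = 0` for every `φ ∈ C_c^∞(E; E)` with `div φ = 0`, and suppose
`e^{τΔ}g (x₀) → 0` as `τ → ∞` for some `x₀`. Then `g = 0` a.e.: by the annihilator lemma in `L^∞`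
(`IsWeaklyDivFree.exists_ae_eq_const_of_norm_le_of_forall_integral_inner_eq_zero`, run on a bounded
representative) `g` is a.e. a constant `c`, so `e^{τΔ}g (x₀) = c` for all `τ > 0` and `c = 0`. This
is the uniqueness mechanism of Lemarié-Rieusset 2016, Def. 6.4 / Lemma 6.4 (B) ("`div Q = curl Q = 0`,
`Q ∈ 𝓢'` and `e^{τΔ}Q → 0`, thus `Q = 0`") in the tree's encoding. [cite: LemarieRieusset2016, Lemma 6.4 (B)] -/
theorem IsWeaklyDivFree.ae_eq_zero_of_forall_integral_inner_eq_zero_of_tendsto_heatExtension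
    {g : E → E} (hg : AEStronglyMeasurable g volume) {M : ℝ} (hM : ∀ᵐ x ∂(volume : Measure E), ‖g x‖ ≤ M)
    (hdiv : IsWeaklyDivFree g)
    (horth : ∀ φ : E → E, FunctionSpaces.IsTestFunctionOn (⊤ : Opens E) φ → VectorCalculus.IsDivFree φ →
      ∫ x, ⟪g x, φ x⟫ = 0)
    {x₀ : E} (hlim : Tendsto (fun τ => UnboundedOperators.heatExtension g τ x₀) atTop (𝓝 0)) :
    g =ᵐ[volume] 0 := by
  -- a bounded strongly measurable representative
  set g₁ : E → E := hg.mk g with hg₁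
  have hg₁m : StronglyMeasurable g₁ := hg.stronglyMeasurable_mk
  have hgg₁ : g =ᵐ[volume] g₁ := hg.ae_eq_mk
  set g' : E → E := fun x => if ‖g₁ x‖ ≤ M then g₁ x else 0 with hg'
  have hset : MeasurableSet {x | ‖g₁ x‖ ≤ M} :=
    measurableSet_le hg₁m.measurable.norm measurable_const
  have hg'm : StronglyMeasurable g' := StronglyMeasurable.ite hset hg₁m stronglyMeasurable_const
  have hg'b : ∀ x, ‖g' x‖ ≤ max M 0 := fun x => by
    simp only [hg']
    split_ifs with h
    · exact h.trans (le_max_left _ _)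
    · simp
  have hgg' : g =ᵐ[volume] g' := by
    filter_upwards [hgg₁, hM] with x hx hxM
    rw [hx] at hxM
    simp only [hg', if_pos hxM, hx]
  -- transfer of the hypotheses to `g'`
  have hint : ∀ (w : E → E), ∫ x, ⟪g' x, w x⟫ = ∫ x, ⟪g x, w x⟫ := fun w =>
    integral_congr_ae (hgg'.mono fun x hx => by simp only [hx])
  have hdiv' : IsWeaklyDivFree g' := fun θ hθ => by
    rw [hint]
    exact hdiv θ hθ
  have horth' : ∀ φ : E → E, FunctionSpaces.IsTestFunctionOn (⊤ : Opens E) φ → VectorCalculus.IsDivFree φ →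
      ∫ x, ⟪g' x, φ x⟫ = 0 := fun φ hφ hφd => by
    rw [hint]
    exact horth φ hφ hφd
  obtain ⟨c, hc⟩ := hdiv'.exists_ae_eq_const_of_norm_le_of_forall_integral_inner_eq_zero
    hg'm.aestronglyMeasurable hg'b horth'
  -- `e^{τΔ}g (x₀) = c` for `τ > 0`, hence `c = 0`
  have hgc : g =ᵐ[volume] fun _ => c := hgg'.trans hc
  have hconst : ∀ τ : ℝ, 0 < τ → UnboundedOperators.heatExtension g τ x₀ = c := fun τ hτ =>
    heatExtension_eq_const_of_ae_eq hgc hτ x₀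
  have hc0 : c = 0 := by
    have h1 : Tendsto (fun τ : ℝ => UnboundedOperators.heatExtension g τ x₀) atTop (𝓝 c) :=
      tendsto_const_nhds.congr' (by
        filter_upwards [eventually_gt_atTop 0] with τ hτ
        exact (hconst τ hτ).symm)
    exact tendsto_nhds_unique h1 hlim
  rw [hc0] at hgc
  exact hgc

end HeatAnnihilator

/-! ## The heat flow of the Duhamel term: `e^{τΔ}B(u,v)(t) = ∫∫ K(t - s + τ)[u, v] → 0` -/

section DuhamelHeat

/-- **The caloric extension of the Duhamel term** (the semigroup law for the kernel inside the
space–time integral): for fields measurable on `(0, ∞) × E` with finite path norms, `t, τ > 0`,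
`e^{τΔ}[B(u, v)(t)](x) = ∫∫_{(0,t) × E} K(t - s + τ, x - y)[u(s, y), v(s, y)] d(s, y)`
(Fubini over `E × ((0,t) × E)` under the majorant of `KochTataruPointwise.lean`, uniform in the
space variable, and `∫ G_τ(x - w) K(σ, w - y) dw = K(σ + τ, x - y)`,
`integral_heatKernel_sub_smul_oseenKernel_sub`; Lemarié-Rieusset 2016, Thm. 6.1: the Oseen tensor
is a semigroup in time). [cite: LemarieRieusset2016, Thm. 6.1] -/
theorem heatExtension_kochTataruBilinear_eq {u v : ℝ → E → E}
    (hu : AEStronglyMeasurable (uncurry u) ((volume : Measure (ℝ × E)).restrict (Ioi 0 ×ˢ univ)))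
    (hv : AEStronglyMeasurable (uncurry v) ((volume : Measure (ℝ × E)).restrict (Ioi 0 ×ˢ univ)))
    (huX : eKochTataruNorm u < ∞) (hvX : eKochTataruNorm v < ∞) {t : ℝ} (ht : 0 < t) {τ : ℝ}
    (hτ : 0 < τ) (x : E) :
    UnboundedOperators.heatExtension (kochTataruBilinear u v t) τ x =
      ∫ p in Ioo 0 t ×ˢ (univ : Set E), oseenKernel (t - p.1 + τ) (x - p.2) (u p.1 p.2) (v p.1 p.2) := by
  set μ : Measure (ℝ × E) := (volume : Measure (ℝ × E)).restrict (Ioo 0 t ×ˢ univ) with hμ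
  set F : E → ℝ × E → E := fun w p =>
    UnboundedOperators.heatKernel τ (x - w) • oseenKernel (t - p.1) (w - p.2) (u p.1 p.2) (v p.1 p.2) with hF
  -- measurability on the product
  have hsub : Ioo (0 : ℝ) t ×ˢ (univ : Set E) ⊆ Ioi 0 ×ˢ univ := prod_mono Ioo_subset_Ioi_self subset_rfl
  have hu' : AEStronglyMeasurable (fun p : ℝ × E => u p.1 p.2) μ := hu.mono_measure (Measure.restrict_mono hsub le_rfl)
  have hv' : AEStronglyMeasurable (fun p : ℝ × E => v p.1 p.2) μ := hv.mono_measure (Measure.restrict_mono hsub le_rfl)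
  have hFm : AEStronglyMeasurable (uncurry F) ((volume : Measure E).prod μ) := by
    have hK : AEMeasurable (fun q : E × (ℝ × E) =>
        oseenKernel (t - q.2.1) (q.1 - q.2.2) (u q.2.1 q.2.2) (v q.2.1 q.2.2)) ((volume : Measure E).prod μ) := by
      refine AEMeasurable.oseenKernel_comp ?_ ?_ ?_ ?_
      · exact (measurable_const.sub measurable_snd.fst).aemeasurable
      · exact (measurable_fst.sub measurable_snd.snd).aemeasurable
      · exact (hu'.comp_snd (μ := (volume : Measure E))).aemeasurable
      · exact (hv'.comp_snd (μ := (volume : Measure E))).aemeasurable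
    have hG : Measurable (fun q : E × (ℝ × E) => UnboundedOperators.heatKernel τ (x - q.1)) :=
      (UnboundedOperators.continuous_heatKernel τ).measurable.comp (measurable_const.sub measurable_fst)
    exact (hG.aemeasurable.smul hK).aestronglyMeasurable
  -- integrability on the product: the `τ = 0` majorant is uniform in `w`
  obtain ⟨C, hC, hmaj⟩ := exists_lintegral_enorm_oseenKernel_duhamel_le (E := E)
  set M : ℝ≥0∞ := ENNReal.ofReal (C * t ^ (-(1 / 2 : ℝ))) * eKochTataruNorm u * eKochTataruNorm v with hM
  have hMtop : M < ∞ := ENNReal.mul_lt_top (ENNReal.mul_lt_top ENNReal.ofReal_lt_top huX) hvX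
  have hprod : Integrable (uncurry F) ((volume : Measure E).prod μ) := by
    refine ⟨hFm, ?_⟩
    rw [hasFiniteIntegral_iff_enorm, lintegral_prod _ hFm.enorm]
    have hGi : ∫⁻ w, ‖UnboundedOperators.heatKernel τ (x - w)‖ₑ ∂(volume : Measure E) < ∞ :=
      ((UnboundedOperators.integrable_heatKernel_holds hτ).comp_sub_left x).2
    calc ∫⁻ w, ∫⁻ p, ‖uncurry F (w, p)‖ₑ ∂μ
        = ∫⁻ w, ‖UnboundedOperators.heatKernel τ (x - w)‖ₑ *
            ∫⁻ p, ‖oseenKernel (t - p.1) (w - p.2) (u p.1 p.2) (v p.1 p.2)‖ₑ ∂μ := by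
          refine lintegral_congr fun w => ?_
          rw [← lintegral_const_mul' _ _ enorm_ne_top]
          refine lintegral_congr fun p => ?_
          simp only [hF, uncurry_apply_pair, enorm_smul]
      _ ≤ ∫⁻ w, ‖UnboundedOperators.heatKernel τ (x - w)‖ₑ * M := by
          refine lintegral_mono fun w => ?_
          gcongr
          exact hmaj hu hv ht w
      _ = (∫⁻ w, ‖UnboundedOperators.heatKernel τ (x - w)‖ₑ) * M := lintegral_mul_const' _ _ hMtop.ne
      _ < ∞ := ENNReal.mul_lt_top hGi hMtop
  -- the computation
  rw [UnboundedOperators.heatExtension_eq_integral_sub]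
  have hB : ∀ w, kochTataruBilinear u v t w = ∫ p, oseenKernel (t - p.1) (w - p.2) (u p.1 p.2) (v p.1 p.2) ∂μ :=
    fun w => kochTataruBilinear_eq_integral_prod hu hv huX hvX ht w
  simp_rw [hB, ← integral_smul]
  rw [integral_integral_swap hprod]
  refine integral_congr_ae ?_
  rw [hμ]
  filter_upwards [ae_restrict_mem (measurableSet_Ioo.prod MeasurableSet.univ)] with p hp
  rw [mem_prod] at hp
  have hσ : 0 < t - p.1 := sub_pos.2 hp.1.2
  simp only [hF]
  rw [integral_heatKernel_sub_smul_oseenKernel_sub hσ hτ]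

variable (E) in
/-- **The Duhamel term vanishes at infinity under the heat flow** (Lemarié-Rieusset 2016,
Def. 6.5 and Prop. 6.5: solutions in adapted spaces vanish at infinity): there is `C = C(E)` with
`‖e^{τΔ}[B(u, v)(t)](x)‖ ≤ C τ^{-1/2} ‖u‖_X ‖v‖_X` for all fields measurable on `(0, ∞) × E` with
finite path norms, `t, τ > 0`, `x ∈ E` (the decay estimate
`exists_lintegral_enorm_oseenKernel_shifted_le'` for the right-hand side of
`heatExtension_kochTataruBilinear_eq`). [cite: LemarieRieusset2016, Prop. 6.5] -/
theorem exists_norm_heatExtension_kochTataruBilinear_le :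
    ∃ C : ℝ, 0 < C ∧ ∀ {u v : ℝ → E → E},
      AEStronglyMeasurable (uncurry u) ((volume : Measure (ℝ × E)).restrict (Ioi 0 ×ˢ univ)) →
      AEStronglyMeasurable (uncurry v) ((volume : Measure (ℝ × E)).restrict (Ioi 0 ×ˢ univ)) →
      eKochTataruNorm u < ∞ → eKochTataruNorm v < ∞ → ∀ {t : ℝ}, 0 < t → ∀ {τ : ℝ}, 0 < τ → ∀ x : E,
        ‖UnboundedOperators.heatExtension (kochTataruBilinear u v t) τ x‖ ≤
          C * τ ^ (-(1 / 2 : ℝ)) * (eKochTataruNorm u).toReal * (eKochTataruNorm v).toReal := by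
  obtain ⟨C, hC, h⟩ := exists_lintegral_enorm_oseenKernel_shifted_le' E
  refine ⟨C, hC, fun {u v} hu hv huX hvX {t} ht {τ} hτ x => ?_⟩
  rw [heatExtension_kochTataruBilinear_eq hu hv huX hvX ht hτ x]
  refine (norm_integral_le_lintegral_norm _).trans ?_
  simp only [ofReal_norm]
  have hfin : ENNReal.ofReal (C * τ ^ (-(1 / 2 : ℝ))) * eKochTataruNorm u * eKochTataruNorm v ≠ ∞ :=
    ENNReal.mul_ne_top (ENNReal.mul_ne_top ENNReal.ofReal_ne_top huX.ne) hvX.ne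
  refine (ENNReal.toReal_mono hfin (h hu hv x ht hτ)).trans (le_of_eq ?_)
  rw [ENNReal.toReal_mul, ENNReal.toReal_mul, ENNReal.toReal_ofReal (by positivity)]

/-- `e^{τΔ}[B(u, v)(t)](x) → 0` as `τ → ∞`. [cite: LemarieRieusset2016, Prop. 6.5] -/
theorem tendsto_heatExtension_kochTataruBilinear_atTop {u v : ℝ → E → E}
    (hu : AEStronglyMeasurable (uncurry u) ((volume : Measure (ℝ × E)).restrict (Ioi 0 ×ˢ univ)))
    (hv : AEStronglyMeasurable (uncurry v) ((volume : Measure (ℝ × E)).restrict (Ioi 0 ×ˢ univ)))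
    (huX : eKochTataruNorm u < ∞) (hvX : eKochTataruNorm v < ∞) {t : ℝ} (ht : 0 < t) (x : E) :
    Tendsto (fun τ => UnboundedOperators.heatExtension (kochTataruBilinear u v t) τ x) atTop (𝓝 0) := by
  obtain ⟨C, hC, h⟩ := exists_norm_heatExtension_kochTataruBilinear_le E
  set K : ℝ := C * (eKochTataruNorm u).toReal * (eKochTataruNorm v).toReal with hK
  have hlim : Tendsto (fun τ : ℝ => K * τ ^ (-(1 / 2 : ℝ))) atTop (𝓝 0) := by
    have := (tendsto_rpow_neg_atTop (y := (1 / 2 : ℝ)) (by norm_num)).const_mul K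
    simpa using this
  refine squeeze_zero_norm' ?_ hlim
  filter_upwards [eventually_gt_atTop 0] with τ hτ
  calc ‖UnboundedOperators.heatExtension (kochTataruBilinear u v t) τ x‖
      ≤ C * τ ^ (-(1 / 2 : ℝ)) * (eKochTataruNorm u).toReal * (eKochTataruNorm v).toReal :=
        h hu hv huX hvX ht hτ x
    _ = K * τ ^ (-(1 / 2 : ℝ)) := by rw [hK]; ring

end DuhamelHeat

/-! ## The free evolution of the datum against test fields -/

section Datum

/-- The scalar caloric extensions of the two trunks agree:
`UnboundedOperators.heatExtension f t x = BMOInv.heatExtension f t x` for `f : E → ℝ`. [folklore] -/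
theorem heatExtension_real_eq_bmoInv (f : E → ℝ) (t : ℝ) (x : E) :
    UnboundedOperators.heatExtension f t x = FunctionSpaces.BMOInv.heatExtension f t x := by
  rw [UnboundedOperators.heatExtension_eq_integral_sub]
  rfl

omit [InnerProductSpace ℝ E] [FiniteDimensional ℝ E] [MeasurableSpace E] [BorelSpace E] in
/-- A continuous compactly supported field is bounded and supported in a ball about the origin.
[folklore] -/
theorem exists_bound_ball_of_hasCompactSupport {φ : E → E} (hφc : Continuous φ) (hφs : HasCompactSupport φ) :
    ∃ ρ M : ℝ, 0 < ρ ∧ 0 ≤ M ∧ (∀ z, ‖φ z‖ ≤ M) ∧ ∀ z, z ∉ ball (0 : E) ρ → φ z = 0 := by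
  obtain ⟨ρ, hρ, hρφ⟩ : ∃ ρ : ℝ, 0 < ρ ∧ tsupport φ ⊆ ball (0 : E) ρ :=
    hφs.isCompact.isBounded.subset_ball_lt 0 0
  obtain ⟨M, hM⟩ := hφc.bounded_above_of_compact_support hφs
  refine ⟨ρ, max M 0, hρ, le_max_right _ _, fun z => (hM z).trans (le_max_left _ _), fun z hz => ?_⟩
  exact image_eq_zero_of_notMem_tsupport fun h => hz (hρφ h)

/-- **Symmetry of the free evolution against a compactly supported field** (the Gauss–Weierstrass
kernel is even; Fubini): for polynomially tempered `u₀ : E → E`, continuous compactly supported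
`φ : E → E` and `t > 0`, `∫ ⟪e^{tΔ}u₀, φ⟫ = ∫ ⟪u₀, e^{tΔ}φ⟫` — the datum term
`∫ ⟪u₀, e^{tΔ}φ⟫` of the duality form `Fluid.IsMildNSSolutionFrom` is the pairing of the free
evolution `e^{tΔ}u₀` with `φ` (Koch–Tataru 2001, (2) with (11); Lemarié-Rieusset 2016, Thm. 6.1).
Componentwise this is `BMOInv.integral_heatExtension_mul_eq`. [cite: KochTataruAdvMath2001, §1 (2) and §3 (11)] -/
theorem integral_inner_heatExtension_eq_of_hasCompactSupport {u₀ : E → E}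
    (htemp : IsPolynomiallyTempered u₀) {φ : E → E} (hφc : Continuous φ) (hφs : HasCompactSupport φ)
    {t : ℝ} (ht : 0 < t) :
    ∫ x, ⟪UnboundedOperators.heatExtension u₀ t x, φ x⟫ =
      ∫ x, ⟪u₀ x, UnboundedOperators.heatExtension φ t x⟫ := by
  haveI : CompleteSpace E := FiniteDimensional.complete ℝ E
  set e := stdOrthonormalBasis ℝ E with he
  set d : ℕ := Module.finrank ℝ E with hd
  obtain ⟨ρ, M, hρ, hM0, hM, hsupp⟩ := exists_bound_ball_of_hasCompactSupport hφc hφs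
  have hφt : IsPolynomiallyTempered φ :=
    IsPolynomiallyTempered.of_integrable (hφc.integrable_of_hasCompactSupport hφs)
  -- components
  set uc : Fin d → E → ℝ := fun i z => ⟪u₀ z, e i⟫ with huc
  set φc : Fin d → E → ℝ := fun i z => ⟪φ z, e i⟫ with hφcdef
  have hφci : ∀ i, Continuous (φc i) := fun i => hφc.inner continuous_const
  have hφcM : ∀ i z, |φc i z| ≤ M := fun i z =>
    (abs_real_inner_le_norm _ _).trans (by
      calc ‖φ z‖ * ‖e i‖ = ‖φ z‖ := by rw [e.orthonormal.1 i, mul_one]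
        _ ≤ M := hM z)
  have hφcs : ∀ i z, z ∉ ball (0 : E) ρ → φc i z = 0 := fun i z hz => by
    simp only [hφcdef, hsupp z hz, inner_zero_left]
  have hφcint : ∀ i, Integrable (φc i) := fun i =>
    (hφc.integrable_of_hasCompactSupport hφs).inner_const (e i)
  -- pointwise expansions
  have hL : ∀ x, ⟪UnboundedOperators.heatExtension u₀ t x, φ x⟫ =
      ∑ i, FunctionSpaces.BMOInv.heatExtension (uc i) t x * φc i x := fun x => by
    rw [← e.sum_inner_mul_inner (UnboundedOperators.heatExtension u₀ t x) (φ x)]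
    refine Finset.sum_congr rfl fun i _ => ?_
    rw [inner_heatExtension_eq_heatExtension_inner htemp ht x (e i), real_inner_comm (φ x) (e i)]
  have hR : ∀ x, ⟪u₀ x, UnboundedOperators.heatExtension φ t x⟫ =
      ∑ i, uc i x * FunctionSpaces.BMOInv.heatExtension (φc i) t x := fun x => by
    rw [← e.sum_inner_mul_inner (u₀ x) (UnboundedOperators.heatExtension φ t x)]
    refine Finset.sum_congr rfl fun i _ => ?_
    rw [← real_inner_comm (e i) (UnboundedOperators.heatExtension φ t x),
      inner_heatExtension_eq_heatExtension_inner hφt ht x (e i)]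
  -- integrability and the componentwise symmetry
  have hcomp : ∀ i, Integrable (fun x => FunctionSpaces.BMOInv.heatExtension (uc i) t x * φc i x) ∧
      Integrable (fun x => uc i x * FunctionSpaces.BMOInv.heatExtension (φc i) t x) ∧
      ∫ x, FunctionSpaces.BMOInv.heatExtension (uc i) t x * φc i x =
        ∫ x, uc i x * FunctionSpaces.BMOInv.heatExtension (φc i) t x := by
    intro i
    obtain ⟨N, hN⟩ := htemp.inner_const (e i)
    have hfw := FunctionSpaces.BMOInv.integrable_growth_of_tempered hN
    set K : ℕ := 2 * N with hK
    -- decay bound of the compactly supported component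
    set n : ℕ := K + (d + 1) with hn
    have hCφ : ∀ y, |φc i y| ≤ M * (1 + ρ) ^ n * ((1 + ‖y - 0‖) ^ n)⁻¹ := by
      intro y
      rw [sub_zero]
      by_cases hy : y ∈ ball (0 : E) ρ
      · rw [mem_ball_zero_iff] at hy
        have h1 : (1 + ‖y‖) ^ n ≤ (1 + ρ) ^ n := by gcongr
        have h2 : (1 : ℝ) ≤ (1 + ρ) ^ n * ((1 + ‖y‖) ^ n)⁻¹ := by
          rw [← div_eq_mul_inv, one_le_div (by positivity)]; exact h1
        calc |φc i y| ≤ M := hφcM i y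
          _ ≤ M * ((1 + ρ) ^ n * ((1 + ‖y‖) ^ n)⁻¹) := le_mul_of_one_le_right hM0 h2
          _ = _ := by ring
      · rw [hφcs i y hy, abs_zero]; positivity
    have hsymm := FunctionSpaces.BMOInv.integral_heatExtension_mul_eq hfw (hφci i).aestronglyMeasurable hCφ ht
    have hi2 : Integrable (fun x => uc i x * FunctionSpaces.BMOInv.heatExtension (φc i) t x) :=
      FunctionSpaces.BMOInv.integrable_mul_heatExtension_of_growth hfw (hφcint i) hρ (hφcM i) (hφcs i) ht
    have hi1 : Integrable (fun x => FunctionSpaces.BMOInv.heatExtension (uc i) t x * φc i x) := by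
      obtain ⟨C, hC0, hC⟩ := FunctionSpaces.BMOInv.exists_unif_bound_heatExtension hfw ht le_rfl
      have hmeas : AEStronglyMeasurable (fun x => FunctionSpaces.BMOInv.heatExtension (uc i) t x) volume :=
        ((FunctionSpaces.BMOInv.measurable_heatExtension
          (FunctionSpaces.BMOInv.aestronglyMeasurable_of_growth hfw)).comp
            (measurable_const.prodMk measurable_id)).aestronglyMeasurable
      refine ((hφcint i).norm.const_mul (C * (1 + ρ) ^ K)).mono' (hmeas.mul (hφci i).aestronglyMeasurable)
        (Eventually.of_forall fun x => ?_)
      rw [norm_mul, Real.norm_eq_abs, Real.norm_eq_abs]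
      by_cases hx : x ∈ ball (0 : E) ρ
      · rw [mem_ball_zero_iff] at hx
        calc |FunctionSpaces.BMOInv.heatExtension (uc i) t x| * |φc i x|
            ≤ C * (1 + ‖x‖) ^ K * |φc i x| := by
              gcongr; exact hC t ⟨le_rfl, le_rfl⟩ x
          _ ≤ C * (1 + ρ) ^ K * |φc i x| := by gcongr
      · rw [hφcs i x hx, abs_zero, mul_zero, mul_zero]
    exact ⟨hi1, hi2, hsymm⟩
  calc ∫ x, ⟪UnboundedOperators.heatExtension u₀ t x, φ x⟫
      = ∫ x, ∑ i, FunctionSpaces.BMOInv.heatExtension (uc i) t x * φc i x :=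
        integral_congr_ae (Eventually.of_forall hL)
    _ = ∑ i, ∫ x, FunctionSpaces.BMOInv.heatExtension (uc i) t x * φc i x :=
        integral_finsetSum _ fun i _ => (hcomp i).1
    _ = ∑ i, ∫ x, uc i x * FunctionSpaces.BMOInv.heatExtension (φc i) t x :=
        Finset.sum_congr rfl fun i _ => (hcomp i).2.2
    _ = ∫ x, ∑ i, uc i x * FunctionSpaces.BMOInv.heatExtension (φc i) t x :=
        (integral_finsetSum _ fun i _ => (hcomp i).2.1).symm
    _ = ∫ x, ⟪u₀ x, UnboundedOperators.heatExtension φ t x⟫ :=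
        integral_congr_ae (Eventually.of_forall fun x => (hR x).symm)

/-- `x ↦ ⟪u₀ x, e^{tΔ}φ (x)⟫` is integrable for tempered `u₀` and continuous compactly supported `φ`,
`t > 0`. [folklore] -/
theorem integrable_inner_heatExtension_of_hasCompactSupport {u₀ : E → E}
    (htemp : IsPolynomiallyTempered u₀) {φ : E → E} (hφc : Continuous φ) (hφs : HasCompactSupport φ)
    {t : ℝ} (ht : 0 < t) :
    Integrable fun x => ⟪u₀ x, UnboundedOperators.heatExtension φ t x⟫ := by
  haveI : CompleteSpace E := FiniteDimensional.complete ℝ E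
  set e := stdOrthonormalBasis ℝ E with he
  obtain ⟨ρ, M, hρ, hM0, hM, hsupp⟩ := exists_bound_ball_of_hasCompactSupport hφc hφs
  have hφt : IsPolynomiallyTempered φ :=
    IsPolynomiallyTempered.of_integrable (hφc.integrable_of_hasCompactSupport hφs)
  have hR : (fun x => ⟪u₀ x, UnboundedOperators.heatExtension φ t x⟫) =
      fun x => ∑ i, ⟪u₀ x, e i⟫ * FunctionSpaces.BMOInv.heatExtension (fun z => ⟪φ z, e i⟫) t x := by
    funext x
    rw [← e.sum_inner_mul_inner (u₀ x) (UnboundedOperators.heatExtension φ t x)]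
    refine Finset.sum_congr rfl fun i _ => ?_
    rw [← real_inner_comm (e i) (UnboundedOperators.heatExtension φ t x),
      inner_heatExtension_eq_heatExtension_inner hφt ht x (e i)]
  rw [hR]
  refine integrable_finsetSum _ fun i _ => ?_
  obtain ⟨N, hN⟩ := htemp.inner_const (e i)
  have hfw := FunctionSpaces.BMOInv.integrable_growth_of_tempered hN
  have hgM : ∀ z, |⟪φ z, e i⟫| ≤ M := fun z =>
    (abs_real_inner_le_norm _ _).trans (by
      calc ‖φ z‖ * ‖e i‖ = ‖φ z‖ := by rw [e.orthonormal.1 i, mul_one]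
        _ ≤ M := hM z)
  have hgs : ∀ z, z ∉ ball (0 : E) ρ → ⟪φ z, e i⟫ = 0 := fun z hz => by
    simp only [hsupp z hz, inner_zero_left]
  exact FunctionSpaces.BMOInv.integrable_mul_heatExtension_of_growth hfw
    ((hφc.integrable_of_hasCompactSupport hφs).inner_const (e i)) hρ hgM hgs ht

/-- The heat flow commutes with the gradient of a test function: `e^{tΔ}(∇θ) = ∇(e^{tΔ}θ)`. [folklore] -/
theorem heatExtension_gradient {θ : E → ℝ} (hθ : FunctionSpaces.IsTestFunctionOn (⊤ : Opens E) θ)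
    (t : ℝ) (x : E) :
    UnboundedOperators.heatExtension (gradient θ) t x = gradient (UnboundedOperators.heatExtension θ t) x := by
  haveI : CompleteSpace E := FiniteDimensional.complete ℝ E
  have hθ1 : ContDiff ℝ 1 θ := hθ.contDiff.of_le (by exact_mod_cast le_top)
  have h := UnboundedOperators.heatExtension_clm_comp
    ((InnerProductSpace.toDual ℝ E).symm : (E →L[ℝ] ℝ) →L[ℝ] E)
    (hθ1.continuous_fderiv one_ne_zero) (hθ.hasCompactSupport.fderiv (𝕜 := ℝ)) t x
  rw [gradient, UnboundedOperators.fderiv_heatExtension_of_hasCompactSupport hθ1 hθ.hasCompactSupport t x]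
  exact h

/-- **The free evolution of weakly divergence-free tempered data is weakly divergence free**
(Koch–Tataru 2001, §3: the solution of (11) is built from `S(t)u₀` with `div u₀ = 0`;
Lemarié-Rieusset 2016, Cor. 6.2: `div e^{νtΔ}u₀ = e^{νtΔ} div u₀ = 0`): for `θ ∈ C_c^∞`,
`∫ ⟪e^{tΔ}u₀, ∇θ⟫ = ∫ ⟪u₀, e^{tΔ}∇θ⟫ = ∫ D(e^{tΔ}θ)(u₀) = 0` by the weak divergence-free condition
extended to the smooth, Gaussian-decaying function `e^{tΔ}θ`
(`IsWeaklyDivFree.integral_fderiv_apply_eq_zero`). [cite: LemarieRieusset2016, Cor. 6.2] -/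
theorem isWeaklyDivFree_heatExtension {u₀ : E → E} (hdiv : IsWeaklyDivFree u₀)
    (htemp : IsPolynomiallyTempered u₀) {t : ℝ} (ht : 0 < t) :
    IsWeaklyDivFree (fun x => UnboundedOperators.heatExtension u₀ t x) := by
  haveI : CompleteSpace E := FiniteDimensional.complete ℝ E
  intro θ hθ
  have hθ1 : ContDiff ℝ 1 θ := hθ.contDiff.of_le (by exact_mod_cast le_top)
  have hgc : Continuous (gradient θ) := continuous_gradient_of_contDiff hθ1
  have hgs : HasCompactSupport (gradient θ) :=
    (hθ.hasCompactSupport.fderiv (𝕜 := ℝ)).comp_left (g := (InnerProductSpace.toDual ℝ E).symm) (map_zero _)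
  rw [integral_inner_heatExtension_eq_of_hasCompactSupport htemp hgc hgs ht]
  -- `⟪u₀, e^{tΔ}∇θ⟫ = D(e^{tΔ}θ)(u₀)`
  set Θ : E → ℝ := UnboundedOperators.heatExtension θ t with hΘdef
  have hΘ : ContDiff ℝ ((⊤ : ℕ∞) : WithTop ℕ∞) Θ :=
    UnboundedOperators.contDiff_heatExtension_of_hasCompactSupport hθ.contDiff hθ.hasCompactSupport t
  have hpt : ∀ x, ⟪u₀ x, UnboundedOperators.heatExtension (gradient θ) t x⟫ = fderiv ℝ Θ x (u₀ x) := fun x => by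
    rw [heatExtension_gradient hθ t x, inner_gradient_eq_fderiv_apply]
  simp_rw [hpt]
  have h1 : Integrable (fun x => fderiv ℝ Θ x (u₀ x)) := by
    have := integrable_inner_heatExtension_of_hasCompactSupport htemp hgc hgs ht
    exact this.congr (Eventually.of_forall hpt)
  have h2 : Integrable (fun x => Θ x • u₀ x) := by
    obtain ⟨K, hK⟩ := htemp.integrable_growth_norm
    obtain ⟨ρ, hρ, hρθ⟩ : ∃ ρ : ℝ, 0 < ρ ∧ tsupport θ ⊆ ball (0 : E) ρ :=
      hθ.hasCompactSupport.isCompact.isBounded.subset_ball_lt 0 0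
    obtain ⟨M, hM⟩ := hθ.contDiff.continuous.bounded_above_of_compact_support hθ.hasCompactSupport
    have hθs : ∀ z, z ∉ ball (0 : E) ρ → θ z = 0 := fun z hz =>
      image_eq_zero_of_notMem_tsupport fun h => hz (hρθ h)
    have hθM : ∀ z, |θ z| ≤ max M 0 := fun z => (Real.norm_eq_abs _ ▸ hM z).trans (le_max_left _ _)
    obtain ⟨C, hC0, hC⟩ := FunctionSpaces.BMOInv.exists_abs_heatExtension_le_of_support hρ hθM hθs K ht le_rfl
    refine (hK.const_mul C).mono' ((hΘ.continuous.aestronglyMeasurable).smul htemp.aestronglyMeasurable)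
      (Eventually.of_forall fun x => ?_)
    rw [norm_smul, Real.norm_eq_abs, hΘdef, heatExtension_real_eq_bmoInv]
    have h := hC t ⟨le_rfl, le_rfl⟩ x
    rw [sub_zero] at h
    calc |FunctionSpaces.BMOInv.heatExtension θ t x| * ‖u₀ x‖ ≤ C * ((1 + ‖x‖) ^ K)⁻¹ * ‖u₀ x‖ := by gcongr
      _ = C * (((1 + ‖x‖) ^ K)⁻¹ * ‖u₀ x‖) := by ring
  exact hdiv.integral_fderiv_apply_eq_zero htemp.aestronglyMeasurable hΘ h1 h2

end Datum

/-! ## Positive slices of class solutions solve the integral equation -/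

section PositiveSlices

/-- A field all of whose components are weak divergences (`MemBMOInvVec`) is a.e.-strongly
measurable (its components are locally integrable). [folklore] -/
theorem aestronglyMeasurable_of_memBMOInvVec {h : E → E} (hBMO : FunctionSpaces.MemBMOInvVec h) :
    AEStronglyMeasurable h volume := by
  set e := stdOrthonormalBasis ℝ E
  have hc : ∀ i, AEStronglyMeasurable (fun x => ⟪h x, e i⟫) volume := fun i => by
    obtain ⟨Φ, -, hrep⟩ := hBMO (e i)
    exact hrep.locallyIntegrable.aestronglyMeasurable
  have heq : h = fun x => ∑ i, ⟪h x, e i⟫ • e i := by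
    funext x
    conv_lhs => rw [← e.sum_repr' (h x)]
    exact Finset.sum_congr rfl fun i _ => by rw [real_inner_comm]
  rw [heq]
  exact Finset.aestronglyMeasurable_fun_sum _ fun i _ => (hc i).smul_const (e i)

/-- Integrability against the Gaussian of an a.e. bounded measurable field. [folklore] -/
theorem integrable_heatKernel_sub_smul_of_ae_norm_le {f : E → E} (hf : AEStronglyMeasurable f volume)
    {M : ℝ} (hM : ∀ᵐ x ∂(volume : Measure E), ‖f x‖ ≤ M) {τ : ℝ} (hτ : 0 < τ) (x : E) :
    Integrable fun y => UnboundedOperators.heatKernel τ (x - y) • f y := by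
  have hG := (UnboundedOperators.integrable_heatKernel_holds (E := E) hτ).comp_sub_left x
  refine (hG.mul_const M).mono' (hG.aestronglyMeasurable.smul hf) ?_
  filter_upwards [hM] with y hy
  rw [norm_smul, Real.norm_of_nonneg (UnboundedOperators.heatKernel_pos hτ _).le]
  exact mul_le_mul_of_nonneg_left hy (UnboundedOperators.heatKernel_pos hτ _).le

/-- An a.e. bounded measurable field pairs integrably with a continuous compactly supported field.
[folklore] -/
theorem integrable_inner_of_ae_norm_le {f : E → E} (hf : AEStronglyMeasurable f volume)
    {M : ℝ} (hM : ∀ᵐ x ∂(volume : Measure E), ‖f x‖ ≤ M) {w : E → E} (hw : Continuous w)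
    (hwc : HasCompactSupport w) : Integrable fun x => ⟪f x, w x⟫ := by
  have hl : LocallyIntegrable f volume :=
    (memLp_top_of_bound hf M (hM.mono fun x hx => hx)).locallyIntegrable le_top
  exact integrable_inner_of_locallyIntegrable_of_hasCompactSupport hl hw hwc

/-- **The free evolution of tempered `BMO⁻¹` data is bounded and measurable on each positive
slice**: for `u₀ ∈ BMO⁻¹(E; E)` polynomially tempered and `t > 0`, `x ↦ e^{tΔ}u₀ (x)` is
measurable and `‖e^{tΔ}u₀ (x)‖ ≤ M` for all `x` (componentwise Koch–Tataru (22) with Theorem 1).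
[cite: KochTataruAdvMath2001, Theorem 1 and (22)] -/
theorem exists_norm_heatExtension_le_of_memBMOInvVec {u₀ : E → E} (hmem : FunctionSpaces.MemBMOInvVec u₀)
    (htemp : IsPolynomiallyTempered u₀) {t : ℝ} (ht : 0 < t) :
    AEStronglyMeasurable (fun x => UnboundedOperators.heatExtension u₀ t x) volume ∧
      ∃ M : ℝ, ∀ x, ‖UnboundedOperators.heatExtension u₀ t x‖ ≤ M := by
  set e := stdOrthonormalBasis ℝ E with he
  obtain ⟨C₁, hC₁, habs⟩ := FunctionSpaces.BMOInv.exists_abs_heatExtension_le (E := E)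
  have hcomp : ∀ i, (Measurable fun x => FunctionSpaces.BMOInv.heatExtension (fun z => ⟪u₀ z, e i⟫) t x) ∧
      ∃ K : ℝ, ∀ x, |FunctionSpaces.BMOInv.heatExtension (fun z => ⟪u₀ z, e i⟫) t x| ≤ K := by
    intro i
    obtain ⟨N, hN⟩ := htemp.inner_const (e i)
    have hfw := FunctionSpaces.BMOInv.integrable_growth_of_tempered hN
    obtain ⟨Φ, -, hrep⟩ := id (hmem (e i))
    have hγ : FunctionSpaces.BMOInv.eCarlesonNorm (fun z => ⟪u₀ z, e i⟫) < ∞ :=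
      (FunctionSpaces.memBMOInv_iff_carleson_heat_holds hrep.locallyIntegrable ⟨N, hN⟩).1 (hmem (e i))
    refine ⟨(FunctionSpaces.BMOInv.measurable_heatExtension
      (FunctionSpaces.BMOInv.aestronglyMeasurable_of_growth hfw)).comp (measurable_const.prodMk measurable_id),
      ⟨_, fun x => habs hfw hγ ht x⟩⟩
  have heq : (fun x => UnboundedOperators.heatExtension u₀ t x) =
      fun x => ∑ i, FunctionSpaces.BMOInv.heatExtension (fun z => ⟪u₀ z, e i⟫) t x • e i :=
    funext fun x => heatExtension_eq_sum_heatExtension_inner htemp e ht x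
  refine ⟨?_, ?_⟩
  · rw [heq]
    exact (Finset.aestronglyMeasurable_fun_sum _ fun i _ =>
      (hcomp i).1.aestronglyMeasurable.smul_const (e i))
  · choose K hK using fun i => (hcomp i).2
    refine ⟨∑ i, K i, fun x => ?_⟩
    rw [heatExtension_eq_sum_heatExtension_inner htemp e ht x]
    refine (norm_sum_le _ _).trans (Finset.sum_le_sum fun i _ => ?_)
    rw [norm_smul, Real.norm_eq_abs, e.orthonormal.1 i, mul_one]
    exact hK i x

/-- **Positive slices of a Koch–Tataru class solution solve the integral equation (11)**
(Koch–Tataru 2001, Theorem 2 with §3 (11); Lemarié-Rieusset 2016, Thm. 6.1, (6.11) ⇒ (6.12) with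
Lemma 6.4 (B) and Prop. 6.5): if `u₀` is weakly divergence free, polynomially tempered and in
`BMO⁻¹(E; E)`, `v` is a solution in Koch–Tataru's class from `u₀` and `‖v‖_X < ∞`, then for every
`t > 0`, `v(t) = e^{tΔ}u₀ - B(v, v)(t)` a.e. The field `g = v(t) - e^{tΔ}u₀ + B(v,v)(t)` is bounded,
measurable, weakly solenoidal, annihilated by solenoidal tests (duality identity of the class,
`integral_inner_heatExtension_eq_of_hasCompactSupport`, `integral_inner_kochTataruBilinear_eq_neg_intervalIntegral`),
and `e^{τΔ}g (0) → 0` (`tendsto_heatExtension_atTop_of_memBMOInvVec` for `v(t)` and `e^{tΔ}u₀`,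
`tendsto_heatExtension_kochTataruBilinear_atTop` for `B`), so it vanishes a.e.
[cite: LemarieRieusset2016, Thm. 6.1 ((6.11) ⇒ (6.12)), Lemma 6.4 (B) and Prop. 6.5] -/
theorem IsKochTataruSolution.ae_eq_heatExtension_sub_kochTataruBilinear {u₀ : E → E} {v : ℝ → E → E}
    (hdiv : IsWeaklyDivFree u₀) (hmem : FunctionSpaces.MemBMOInvVec u₀) (htemp : IsPolynomiallyTempered u₀)
    (hv : IsKochTataruSolution u₀ v) (hvX : eKochTataruNorm v < ∞) {t : ℝ} (ht : 0 < t) :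
    v t =ᵐ[volume] fun x => UnboundedOperators.heatExtension u₀ t x - kochTataruBilinear v v t x := by
  haveI : CompleteSpace E := FiniteDimensional.complete ℝ E
  set S : E → E := fun x => UnboundedOperators.heatExtension u₀ t x with hS
  set B : E → E := kochTataruBilinear v v t with hB
  set g : E → E := fun x => v t x - S x + B x with hg
  have hvm := hv.aestronglyMeasurable
  -- slice facts for `v t`
  have hvt_m : AEStronglyMeasurable (v t) volume := aestronglyMeasurable_of_memBMOInvVec (hv.memBMOInvVec t ht.le)
  set Nv : ℝ≥0∞ := (ENNReal.ofReal (Real.sqrt t))⁻¹ * eKochTataruNorm v with hNv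
  have hNvtop : Nv ≠ ∞ := ENNReal.mul_ne_top
    (ENNReal.inv_ne_top.2 (by simpa [ENNReal.ofReal_eq_zero, not_le] using Real.sqrt_pos.2 ht)) hvX.ne
  have hvt_b : ∀ᵐ x ∂(volume : Measure E), ‖v t x‖ ≤ Nv.toReal := by
    filter_upwards [ae_enorm_slice_le v ht] with x hx
    have := ENNReal.toReal_mono hNvtop hx
    rwa [toReal_enorm] at this
  -- slice facts for `S = e^{tΔ}u₀`
  obtain ⟨hS_m, MS, hS_b⟩ := exists_norm_heatExtension_le_of_memBMOInvVec hmem htemp ht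
  have hS_BMO : FunctionSpaces.MemBMOInvVec S := hmem.heatExtension htemp ht
  have hS_div : IsWeaklyDivFree S := isWeaklyDivFree_heatExtension hdiv htemp ht
  -- slice facts for `B`
  have hB_m : AEStronglyMeasurable B volume := (stronglyMeasurable_kochTataruBilinear_slice hvm hvm t).aestronglyMeasurable
  obtain ⟨MB, -, hB_b⟩ := exists_norm_kochTataruBilinear_le hvm hvm hvX hvX ht
  have hB_div : IsWeaklyDivFree B := isWeaklyDivFree_kochTataruBilinear hvm hvm hvX hvX t
  -- the field `g`
  have hg_m : AEStronglyMeasurable g volume := (hvt_m.sub hS_m).add hB_m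
  have hg_b : ∀ᵐ x ∂(volume : Measure E), ‖g x‖ ≤ Nv.toReal + MS + MB := by
    filter_upwards [hvt_b] with x hx
    calc ‖g x‖ ≤ ‖v t x - S x‖ + ‖B x‖ := norm_add_le _ _
      _ ≤ (‖v t x‖ + ‖S x‖) + ‖B x‖ := by gcongr; exact norm_sub_le _ _
      _ ≤ (Nv.toReal + MS) + MB := by gcongr <;> first | exact hS_b x | exact hB_b x
  -- pairings split
  have hsplit : ∀ {w : E → E}, Continuous w → HasCompactSupport w →
      ∫ x, ⟪g x, w x⟫ = (∫ x, ⟪v t x, w x⟫) - (∫ x, ⟪S x, w x⟫) + ∫ x, ⟪B x, w x⟫ := by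
    intro w hw hwc
    have i1 := integrable_inner_of_ae_norm_le hvt_m hvt_b hw hwc
    have i2 := integrable_inner_of_ae_norm_le hS_m (Eventually.of_forall hS_b) hw hwc
    have i3 := integrable_inner_of_ae_norm_le hB_m (Eventually.of_forall hB_b) hw hwc
    have i12 : Integrable (fun x => ⟪v t x, w x⟫ - ⟪S x, w x⟫) := i1.sub i2
    rw [← integral_sub i1 i2, ← integral_add i12 i3]
    refine integral_congr_ae (Eventually.of_forall fun x => ?_)
    simp only [hg, inner_add_left, inner_sub_left]
  -- `g` is weakly divergence free
  have hg_div : IsWeaklyDivFree g := by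
    intro θ hθ
    have hθ1 : ContDiff ℝ 1 θ := hθ.contDiff.of_le (by exact_mod_cast le_top)
    have hgc : Continuous (gradient θ) := continuous_gradient_of_contDiff hθ1
    have hgs : HasCompactSupport (gradient θ) :=
      (hθ.hasCompactSupport.fderiv (𝕜 := ℝ)).comp_left (g := (InnerProductSpace.toDual ℝ E).symm) (map_zero _)
    rw [hsplit hgc hgs, hv.isWeaklyDivFree ht.le θ hθ, hS_div θ hθ, hB_div θ hθ]
    ring
  -- `g` is annihilated by solenoidal tests
  have hg_orth : ∀ φ : E → E, FunctionSpaces.IsTestFunctionOn (⊤ : Opens E) φ → VectorCalculus.IsDivFree φ →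
      ∫ x, ⟪g x, φ x⟫ = 0 := by
    intro φ hφ hφd
    have hmild := hv.isGlobalMildSolution.2 t ht.le φ hφ hφd
    have hforce : ∫ τ in (0:ℝ)..t, ∫ x, ⟪(0 : ℝ → E → E) τ x, heatTest 1 φ (t - τ) x⟫ = 0 := by
      simp [inner_zero_left]
    rw [hforce, add_zero, heatTest_of_pos one_pos ht, one_mul] at hmild
    rw [hsplit hφ.contDiff.continuous hφ.hasCompactSupport, hmild,
      integral_inner_heatExtension_eq_of_hasCompactSupport htemp hφ.contDiff.continuous hφ.hasCompactSupport ht,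
      integral_inner_kochTataruBilinear_eq_neg_intervalIntegral hvm hvX ht hφ hφd]
    ring
  -- the heat flow of `g` at the origin tends to zero
  have hg_heat : Tendsto (fun τ => UnboundedOperators.heatExtension g τ 0) atTop (𝓝 0) := by
    have h1 := tendsto_heatExtension_atTop_of_memBMOInvVec hvt_m hvt_b (hv.memBMOInvVec t ht.le) 0
    have h2 := tendsto_heatExtension_atTop_of_memBMOInvVec hS_m (Eventually.of_forall hS_b) hS_BMO 0
    have h3 := tendsto_heatExtension_kochTataruBilinear_atTop hvm hvm hvX hvX ht (0 : E)
    have hsum := (h1.sub h2).add h3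
    rw [sub_zero, zero_add] at hsum
    refine hsum.congr' ?_
    filter_upwards [eventually_gt_atTop 0] with τ hτ
    have i1 := integrable_heatKernel_sub_smul_of_ae_norm_le hvt_m hvt_b hτ 0
    have i2 := integrable_heatKernel_sub_smul_of_ae_norm_le hS_m (Eventually.of_forall hS_b) hτ 0
    have i3 := integrable_heatKernel_sub_smul_of_ae_norm_le hB_m (Eventually.of_forall hB_b) hτ 0
    have i12 : Integrable (fun y => UnboundedOperators.heatKernel τ (0 - y) • v t y -
        UnboundedOperators.heatKernel τ (0 - y) • S y) := i1.sub i2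
    rw [UnboundedOperators.heatExtension_eq_integral_sub, UnboundedOperators.heatExtension_eq_integral_sub,
      UnboundedOperators.heatExtension_eq_integral_sub, UnboundedOperators.heatExtension_eq_integral_sub,
      ← integral_sub i1 i2, ← integral_add i12 i3]
    refine integral_congr_ae (Eventually.of_forall fun y => ?_)
    simp only [hg, smul_add, smul_sub]
  -- conclude
  have hg0 := IsWeaklyDivFree.ae_eq_zero_of_forall_integral_inner_eq_zero_of_tendsto_heatExtension
    hg_m hg_b hg_div hg_orth hg_heat
  filter_upwards [hg0] with x hx
  have hx' : v t x - S x + B x = 0 := hx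
  calc v t x = (v t x - S x + B x) + (S x - B x) := by abel
    _ = S x - B x := by rw [hx', zero_add]

end PositiveSlices




end Literature.Analysis.FluidPDE
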